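import Literature.AlgebraicGeometry.FundamentalGroup.RiemannExistenceQbarDescentProofs
import Literature.AlgebraicGeometry.FundamentalGroup.RiemannExistenceCovering
import HarnessLib

/-!
# Crux stmt-HodgeConjecture-2409, line `IdeatorFiveSketch`: the covering debt C from Riemann existence over `ℂ` and CONNECTED weak descent

Helper file (theorems only; `--supports stmt-HodgeConjecture-2409`) for the skeleton
`Cruxes/MiddleDivisorSupportFourfold/Lines/IdeatorFiveSketch.lean` of the crux
`LinearSystemTorelli.MiddleDivisorSupportFourfold`.  Since skeleton v5 the named fact C
(`FundamentalGroup.riemannExistence_qbarDescent_of_finiteIndex`, consumed by the proved stub B,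
p119525) is DERIVED from two stubs by the tree's
`FundamentalGroup.riemannExistence_qbarDescent_of_finiteIndex_of_riemannExistence_of_weakDescent`
(p121703): C1 = Riemann's existence theorem over `ℂ` in covering form (the named fact
`FundamentalGroup.riemannExistence_finiteCovering`, p123138) and C2 = WEAK descent of finite étale
covers along `ℚ̄ ⊂ ℂ` up to homeomorphism over `S(ℂ)`, for ALL finite étale covers
`g : S' → S₀ ⊗_σ ℂ`.

The reduction `…_of_coveringInput` through which C is obtained applies descent only to the cover
that Riemann existence attaches to a CONNECTED finite topological covering `T → S(ℂ)` (the covering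
of the normal core of a finite-index subgroup of `π₁`), i.e. to a finite étale `g : S' → S₀ ⊗_σ ℂ`
whose complex points `S'(ℂ) ≃ₜ T` are connected and whose total space — étale over the smooth
`S₀ ⊗_σ ℂ`, hence smooth — is irreducible
(`HodgeTheory.irreducibleSpace_left_of_connectedSpace_complexPoints`).  This file records that the
composition therefore needs weak descent only for such covers:

* `linearSystemTorelli_finiteCovering_descends_to_qbar_of_riemannExistence_of_connectedWeakDescent`
  — the covering input `hRE` of `…_of_coveringInput` from C1 and CONNECTED weak descent (the tree's
  `HodgeTheory.finiteCovering_descends_to_qbar_of_riemannExistence_of_weakDescent` with the descent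
  hypothesis weakened by the two extra hypotheses `IrreducibleSpace S'.left`,
  `ConnectedSpace (ComplexPoints S')`, both supplied inside the proof);
* `linearSystemTorelli_riemannExistence_qbarDescent_of_finiteIndex_of_riemannExistence_of_connectedWeakDescent`
  — C ⟸ C1 + connected weak descent;
* `linearSystemTorelli_connectedWeakDescent_of_weakDescent`,
  `linearSystemTorelli_connectedWeakDescent_of_descent` — connected weak descent follows both from
  the unrestricted weak descent (binder `hDescent` of p121703) and from descent of connected finite
  étale covers as an isomorphism of schemes (binder `hDescent` of
  `HodgeTheory.finiteCovering_descends_to_qbar_of_riemannExistence_of_smooth`, the shape of SGA1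
  XIII Prop. 4.6), so that a landing of either shape closes the reshaped stub C2' of skeleton v7.

## References

* [SGA1] A. Grothendieck, M. Raynaud, SGA 1 (arXiv:math/0206203), Exp. XII Thm. 5.1 (p. 333),
  Prop. 2.4; Exp. XIII Prop. 4.6 (pp. 421–422).
* [HatcherAT2002] A. Hatcher, Algebraic Topology (2002), §1.3 Prop. 1.36, Prop. 1.32, Thm. 1.38.
* [Voisin2007HodgeLoci] C. Voisin, Hodge loci and absolute Hodge classes, Compositio Math. 143
  (2007), §3, proof of Prop. 0.7.
-/

noncomputable section

-- every declaration of this problem lives in `Summit.HodgeConjecture.HodgeConjecture.…`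
set_option linter.dupNamespace false

open CategoryTheory AlgebraicGeometry
open _root_.Topology

namespace Summit.HodgeConjecture.HodgeConjecture.Theorems

open Literature.AlgebraicGeometry Literature.AlgebraicGeometry.Motives
open Literature.AlgebraicGeometry.HodgeTheory Literature.AlgebraicGeometry.FundamentalGroup
open Literature.AlgebraicGeometry.Resolution

/-- **The covering input from Riemann existence over `ℂ` and CONNECTED weak descent.**  Let
`q : T → S(ℂ)` be a connected finite topological covering of the complex points of
`S = S₀ ⊗_σ ℂ`, `S₀` a smooth irreducible quasi-projective `ℚ̄`-scheme.  By Riemann's existence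
theorem (C1, `FundamentalGroup.riemannExistence_finiteCovering`, SGA1 XII Thm. 5.1) `T ≃ₜ S'(ℂ)`
over `S(ℂ)` for a finite étale `g : S' → S`; then `S'(ℂ)` is connected and `S'`, étale over the
smooth `S`, is smooth, hence irreducible (SGA1 XII Prop. 2.4,
`irreducibleSpace_left_of_connectedSpace_complexPoints`); so the CONNECTED weak descent
(`hDescent`: a finite étale cover of `S₀ ⊗_σ ℂ` with irreducible total space and connected complex
points is homeomorphic OVER `S(ℂ)` to the complexification of a finite étale cover of `S₀` — the
consumed part of SGA1 XIII Prop. 4.6) applies and gives `S'(ℂ) ≃ₜ S''₀(ℂ)` over `S(ℂ)` for a finite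
étale `g₀ : S''₀ → S₀` over `ℚ̄`; composing, `T ≃ₜ S''₀(ℂ)` over `S(ℂ)`, and `S''₀` is
quasi-projective exactly as in the tree's
`finiteCovering_descends_to_qbar_of_riemannExistence_of_weakDescent` (whose proof this is, with
the two extra hypotheses of `hDescent` discharged).
[cite: SGA1, Exp. XII Thm. 5.1 (p. 333), Prop. 2.4, and Exp. XIII Prop. 4.6 (pp. 421–422)]
[cite: DeJong1996, 4.17 (p. 72)] -/
theorem linearSystemTorelli_finiteCovering_descends_to_qbar_of_riemannExistence_of_connectedWeakDescent
    (hRiemann : riemannExistence_finiteCovering)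
    (hDescent : ∀ (σ : AlgebraicClosure ℚ →+* ℂ) (S₀ : SchemeOver (AlgebraicClosure ℚ)),
      IsQuasiProjectiveOver S₀ → IrreducibleSpace S₀.left → AlgebraicGeometry.Smooth S₀.hom →
      ∀ ⦃S' : SchemeOver ℂ⦄ (g : S' ⟶ (baseChangeHom σ).obj S₀),
        IsFinite g.left → Etale g.left → IrreducibleSpace S'.left →
        ConnectedSpace (ComplexPoints S') →
        ∃ (S''₀ : SchemeOver (AlgebraicClosure ℚ)) (g₀ : S''₀ ⟶ S₀)
          (Ψ : ComplexPoints ((baseChangeHom σ).obj S''₀) ≃ₜ ComplexPoints S'),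
          IsFinite g₀.left ∧ Etale g₀.left ∧
            ∀ z, AlgPoints.map g (Ψ z) = AlgPoints.map ((baseChangeHom σ).map g₀) z)
    (σ : AlgebraicClosure ℚ →+* ℂ) (S₀ : SchemeOver (AlgebraicClosure ℚ))
    (hS₀ : IsQuasiProjectiveOver S₀) (hS₀sm : AlgebraicGeometry.Smooth S₀.hom)
    (hS₀irr : IrreducibleSpace S₀.left)
    (T : Type) [TopologicalSpace T] [ConnectedSpace T]
    (q : T → ComplexPoints ((baseChangeHom σ).obj S₀)) (hq : IsCoveringMap q)
    (hqfin : ∀ t, (q ⁻¹' {t}).Finite) :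
    ∃ (S''₀ : SchemeOver (AlgebraicClosure ℚ)) (g₀ : S''₀ ⟶ S₀)
      (Φ : ComplexPoints ((baseChangeHom σ).obj S''₀) ≃ₜ T),
      IsFinite g₀.left ∧ Etale g₀.left ∧ IsQuasiProjectiveOver S''₀ ∧
        ∀ z, q (Φ z) = AlgPoints.map ((baseChangeHom σ).map g₀) z := by
  haveI := hS₀sm
  haveI := hS₀irr
  have hS : IsQuasiProjectiveOver ((baseChangeHom σ).obj S₀) := hS₀.baseChangeHom σ
  -- Riemann existence (C1): `T = S'(ℂ)` for a finite étale `g : S' → S₀ ⊗_σ ℂ`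
  obtain ⟨S', g, Φ₁, hfin, het, hΦ₁⟩ := hRiemann _ hS T q hq hqfin
  haveI := hfin
  haveI := het
  -- `S'` is smooth (étale over the smooth `S₀ ⊗_σ ℂ`) with connected complex points (`≃ₜ T`),
  -- hence irreducible
  haveI : AlgebraicGeometry.Smooth ((baseChangeHom σ).obj S₀).hom := by
    change AlgebraicGeometry.Smooth (Limits.pullback.snd S₀.hom _)
    infer_instance
  haveI : AlgebraicGeometry.Smooth S'.hom := by
    rw [← Over.w g]
    infer_instance
  haveI hconn : ConnectedSpace (ComplexPoints S') :=
    Φ₁.symm.surjective.connectedSpace Φ₁.symm.continuous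
  haveI hirr : IrreducibleSpace S'.left := irreducibleSpace_left_of_connectedSpace_complexPoints
  -- connected weak descent: `S'(ℂ) ≃ₜ S''₀(ℂ)` over `S(ℂ)` for a finite étale `g₀ : S''₀ → S₀`
  obtain ⟨S''₀, g₀, Ψ, hfin₀, het₀, hΨ⟩ := hDescent σ S₀ hS₀ hS₀irr hS₀sm g hfin het hirr hconn
  haveI := hfin₀
  haveI := het₀
  -- `S''₀ ⊗_σ ℂ` is smooth with connected complex points, hence irreducible; so is `S''₀`
  set g' : (baseChangeHom σ).obj S''₀ ⟶ (baseChangeHom σ).obj S₀ := (baseChangeHom σ).map g₀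
    with hg'
  haveI : Etale g'.left := etale_baseChangeHom_map_left σ g₀
  haveI : AlgebraicGeometry.Smooth ((baseChangeHom σ).obj S''₀).hom := by
    rw [← Over.w g']
    infer_instance
  haveI : ConnectedSpace (ComplexPoints ((baseChangeHom σ).obj S''₀)) :=
    (Ψ.trans Φ₁).symm.surjective.connectedSpace (Ψ.trans Φ₁).symm.continuous
  haveI : IrreducibleSpace ((baseChangeHom σ).obj S''₀).left :=
    irreducibleSpace_left_of_connectedSpace_complexPoints
  haveI : IrreducibleSpace S''₀.left := irreducibleSpace_of_irreducibleSpace_baseChangeHom_obj σ S''₀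
  -- `S₀` and `S''₀` are integral
  have hS₀reg : Scheme.IsRegular S₀.left :=
    Scheme.IsRegular.of_smooth S₀.hom (Scheme.isRegular_Spec (CommRingCat.of (AlgebraicClosure ℚ)))
  haveI : IsReduced S₀.left := hS₀reg.isReduced
  haveI : IsIntegral S₀.left := isIntegral_of_irreducibleSpace_of_isReduced _
  haveI : AlgebraicGeometry.Smooth S''₀.hom := by
    rw [← Over.w g₀]
    infer_instance
  have hS''reg : Scheme.IsRegular S''₀.left :=
    Scheme.IsRegular.of_smooth S''₀.hom (Scheme.isRegular_Spec (CommRingCat.of (AlgebraicClosure ℚ)))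
  haveI : IsReduced S''₀.left := hS''reg.isReduced
  haveI : IsIntegral S''₀.left := isIntegral_of_irreducibleSpace_of_isReduced _
  -- `g₀` is surjective: closed (finite) and open (étale) onto the irreducible `S₀`
  haveI : Surjective g₀.left := by
    refine ⟨fun y => ?_⟩
    have huniv : Set.range g₀.left = Set.univ :=
      IsClopen.eq_univ ⟨g₀.left.isClosedMap.isClosed_range, g₀.left.isOpenMap.isOpen_range⟩
        (Set.range_nonempty _)
    show y ∈ Set.range g₀.left
    rw [huniv]
    trivial
  refine ⟨S''₀, g₀, Ψ.trans Φ₁, hfin₀, het₀,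
    isQuasiProjectiveOver_of_isFinite_of_surjective g₀ hS₀, fun z ↦ ?_⟩
  rw [Homeomorph.trans_apply, hΦ₁, hΨ]

/-- **C ⟸ C1 + CONNECTED weak descent.**  The named fact
`FundamentalGroup.riemannExistence_qbarDescent_of_finiteIndex` (Riemann existence with `ℚ̄`-descent
in the `π₁`/finite-index form consumed by Voisin's argument) follows from Riemann's existence
theorem over `ℂ` in covering form (C1, the named fact `FundamentalGroup.riemannExistence_finiteCovering`,
SGA1 XII Thm. 5.1) and weak descent along `ℚ̄ ⊂ ℂ`, up to homeomorphism over `S(ℂ)`, of those finite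
étale covers `g : S' → S₀ ⊗_σ ℂ` whose total space is irreducible and whose complex points are
connected (the consumed part of SGA1 XIII Prop. 4.6): the tree's
`riemannExistence_qbarDescent_of_finiteIndex_of_coveringInput` (classification of coverings via the
normal core, PROVED there) only ever descends the cover of a CONNECTED covering space.
[cite: SGA1, Exp. XII Thm. 5.1 (p. 333) and Exp. XIII Prop. 4.6 (pp. 421–422)]
[cite: HatcherAT2002, §1.3 Thm. 1.38 with Prop. 1.36 and Prop. 1.32] -/
theorem linearSystemTorelli_riemannExistence_qbarDescent_of_finiteIndex_of_riemannExistence_of_connectedWeakDescent :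
    Literature.AlgebraicGeometry.FundamentalGroup.riemannExistence_finiteCovering →
    (∀ (σ : AlgebraicClosure ℚ →+* ℂ) (S₀ : SchemeOver (AlgebraicClosure ℚ)), IsQuasiProjectiveOver S₀ →
      IrreducibleSpace S₀.left → AlgebraicGeometry.Smooth S₀.hom →
      ∀ ⦃S' : SchemeOver ℂ⦄ (g : S' ⟶ (baseChangeHom σ).obj S₀), IsFinite g.left → Etale g.left →
        IrreducibleSpace S'.left → ConnectedSpace (ComplexPoints S') →
        ∃ (S''₀ : SchemeOver (AlgebraicClosure ℚ)) (g₀ : S''₀ ⟶ S₀)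
          (Ψ : ComplexPoints ((baseChangeHom σ).obj S''₀) ≃ₜ ComplexPoints S'), IsFinite g₀.left ∧
          Etale g₀.left ∧ ∀ z, AlgPoints.map g (Ψ z) = AlgPoints.map ((baseChangeHom σ).map g₀) z) →
    Literature.AlgebraicGeometry.FundamentalGroup.riemannExistence_qbarDescent_of_finiteIndex :=
  fun hRiemann hDescent ↦
    riemannExistence_qbarDescent_of_finiteIndex_of_coveringInput
      fun σ S₀ hqp hsm hirr T _ _ q hq hqfin ↦
        linearSystemTorelli_finiteCovering_descends_to_qbar_of_riemannExistence_of_connectedWeakDescent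
          hRiemann hDescent σ S₀ hqp hsm hirr T q hq hqfin

/-- Connected weak descent is a special case of the unrestricted weak descent (the binder
`hDescent` of the tree's `riemannExistence_qbarDescent_of_finiteIndex_of_riemannExistence_of_weakDescent`,
p121703): drop the two extra hypotheses. [folklore] -/
theorem linearSystemTorelli_connectedWeakDescent_of_weakDescent
    (hDescent : ∀ (σ : AlgebraicClosure ℚ →+* ℂ) (S₀ : SchemeOver (AlgebraicClosure ℚ)),
      IsQuasiProjectiveOver S₀ → IrreducibleSpace S₀.left → AlgebraicGeometry.Smooth S₀.hom →
      ∀ ⦃S' : SchemeOver ℂ⦄ (g : S' ⟶ (baseChangeHom σ).obj S₀),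
        IsFinite g.left → Etale g.left →
        ∃ (S''₀ : SchemeOver (AlgebraicClosure ℚ)) (g₀ : S''₀ ⟶ S₀)
          (Ψ : ComplexPoints ((baseChangeHom σ).obj S''₀) ≃ₜ ComplexPoints S'),
          IsFinite g₀.left ∧ Etale g₀.left ∧
            ∀ z, AlgPoints.map g (Ψ z) = AlgPoints.map ((baseChangeHom σ).map g₀) z) :
    ∀ (σ : AlgebraicClosure ℚ →+* ℂ) (S₀ : SchemeOver (AlgebraicClosure ℚ)),
      IsQuasiProjectiveOver S₀ → IrreducibleSpace S₀.left → AlgebraicGeometry.Smooth S₀.hom →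
      ∀ ⦃S' : SchemeOver ℂ⦄ (g : S' ⟶ (baseChangeHom σ).obj S₀),
        IsFinite g.left → Etale g.left → IrreducibleSpace S'.left →
        ConnectedSpace (ComplexPoints S') →
        ∃ (S''₀ : SchemeOver (AlgebraicClosure ℚ)) (g₀ : S''₀ ⟶ S₀)
          (Ψ : ComplexPoints ((baseChangeHom σ).obj S''₀) ≃ₜ ComplexPoints S'),
          IsFinite g₀.left ∧ Etale g₀.left ∧
            ∀ z, AlgPoints.map g (Ψ z) = AlgPoints.map ((baseChangeHom σ).map g₀) z :=
  fun σ S₀ hqp hirr hsm _ g hfin het _ _ ↦ hDescent σ S₀ hqp hirr hsm g hfin het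

/-- Connected weak descent also follows from descent of connected finite étale covers as an
ISOMORPHISM of schemes (the binder `hDescent` of the tree's
`HodgeTheory.finiteCovering_descends_to_qbar_of_riemannExistence_of_smooth`, the shape of SGA1
XIII Prop. 4.6: `π₁(X ×_k Y) ⥲ π₁(X) × π₁(Y)`, so `FEt(S₀) → FEt(S₀ ⊗ ℂ)` is essentially surjective
on connected covers): an irreducible total space is connected, and an isomorphism
`e : S''₀ ⊗_σ ℂ ≅ S'` over `S₀ ⊗_σ ℂ` induces the homeomorphism `e(ℂ)` of complex points over `S(ℂ)`.
[cite: SGA1, Exp. XIII Prop. 4.6 (pp. 421–422)] -/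
theorem linearSystemTorelli_connectedWeakDescent_of_descent
    (hDescent : ∀ (σ : AlgebraicClosure ℚ →+* ℂ) (S₀ : SchemeOver (AlgebraicClosure ℚ)),
      IsQuasiProjectiveOver S₀ → IrreducibleSpace S₀.left →
      ∀ ⦃S' : SchemeOver ℂ⦄ (g : S' ⟶ (baseChangeHom σ).obj S₀),
        IsFinite g.left → Etale g.left → ConnectedSpace S'.left →
        ∃ (S''₀ : SchemeOver (AlgebraicClosure ℚ)) (g₀ : S''₀ ⟶ S₀)
          (e : (baseChangeHom σ).obj S''₀ ≅ S'),
          IsFinite g₀.left ∧ Etale g₀.left ∧ e.hom ≫ g = (baseChangeHom σ).map g₀) :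
    ∀ (σ : AlgebraicClosure ℚ →+* ℂ) (S₀ : SchemeOver (AlgebraicClosure ℚ)),
      IsQuasiProjectiveOver S₀ → IrreducibleSpace S₀.left → AlgebraicGeometry.Smooth S₀.hom →
      ∀ ⦃S' : SchemeOver ℂ⦄ (g : S' ⟶ (baseChangeHom σ).obj S₀),
        IsFinite g.left → Etale g.left → IrreducibleSpace S'.left →
        ConnectedSpace (ComplexPoints S') →
        ∃ (S''₀ : SchemeOver (AlgebraicClosure ℚ)) (g₀ : S''₀ ⟶ S₀)
          (Ψ : ComplexPoints ((baseChangeHom σ).obj S''₀) ≃ₜ ComplexPoints S'),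
          IsFinite g₀.left ∧ Etale g₀.left ∧
            ∀ z, AlgPoints.map g (Ψ z) = AlgPoints.map ((baseChangeHom σ).map g₀) z := by
  intro σ S₀ hqp hirr _ S' g hfin het hirr' _
  haveI := hirr'
  obtain ⟨S''₀, g₀, e, hfin₀, het₀, he⟩ := hDescent σ S₀ hqp hirr g hfin het inferInstance
  refine ⟨S''₀, g₀, AlgPoints.homeomorphOfIso e, hfin₀, het₀, fun z ↦ ?_⟩
  rw [AlgPoints.coe_homeomorphOfIso, ← AlgPoints.map_comp_apply, he]

end Summit.HodgeConjecture.HodgeConjecture.Theorems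

end
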